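import Mathlib
import Summits.QuantumFields.BalabanUV.Beta.FP.FreeBiResolventRowDiffCore

/-!
# `BalabanUV.Beta.FP.FreeBiResolventRowDiff` — road «FP» (binder row D1), lane IR-5′, FILE B-b2 of the `hAB` plan: THE TWO FREE LETTERS of
# `GaugeFactorRowDiffSocket` ON THE CUBIC TORUS — with `Δ = LapS (fun _ ↦ Λ) (n : ℂ)` (lattice factor `n`), `F₁² = (Δ+1)⁻¹(Δ+1)⁻¹`, `∂ = GradOp`,
# `S_ν = shiftM ν`:  `Σ_x ‖((S_ν−1)·∂·F₁²)(i,x)‖ ≤ (1260·48^D)²∕n`  and  `Σ_j ‖((S_ν−1)·∂·F₁²·∂ᴴ)(i,j)‖ ≤ D·(1260·48^D)³·((2∕3)^{−1∕2})³·Γ(½)∕n`,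
# uniformly in the torus side `Λ` — two resp. three differences on a FOURTH-order free resolvent (no `log n`)

HONEST DEPENDENCY (page 1, mandatory): continuum YM on T⁴ ⇐ BetaPertH ∧ nine spine estimates (0/9 proved); BetaPertH ⇐ (D1) ∧ (D4) ∧
CAP+tail; G-an2-4 gates asym, D1 and NE2/3/4.  HONEST FRAMING (cell contract, verbatim): «discharging `BetaPertH` makes Bałaban's UV
stability UNCONDITIONAL — a real constructive-QFT result; it is NOT the continuum limit and NOT the Clay problem.»  THIS MODULE is [folklore] real
analysis (dominated interchange of a finite sum with a Laplace integral, `(1∨s)^{−1∕2} ≤ s^{−1∕2}`, `∫₀^∞u^{−1∕2}e^{−u}du = Γ(½)`) over FILE B-b1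
(`FreeBiResolventKernel.biResolvent_apply_eq_integral`: the entries of `F₁²` are `∫₀^∞ u e^{−u}Π_i q^Λ_{2n²u}((x−y)_i)du`) and FILE B-a (`TorusHeatSemigroup`:
`Σ_z|D_νD_μK_{2s}| ≤ (C(1∨s)^{−1∕2})²`, `Σ_z|D_νD_μD⁻_{μ′}K_{3s}| ≤ (C(1∨s)^{−1∕2})³`, `C = 1260·48^D`), with b05's typed `GradOp`∕`shiftM`∕`LapS`
(`B5Action121`, `B5Prop11Plancherel`).  It cites nothing as a hypothesis, mints no `Prop`, has no `def`, 0 sorry.  NOT hAB (the tower assembly with the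
(T0′) chain's letters is FILE C), NOT (T1′), NOT D1, NOT BetaPertH, NOT continuum, NOT Clay.

ABSOLUTE RULE (cell charter, verbatim): «No internally-minted statement may enter as a cited fact. Every hypothesis is either kernel-proved in this
package or a verbatim quotation of a PUBLISHED theorem with page reference. The manuscript(s) under audit are NOT citable for their own disputed
steps — they are the thing under adjudication; programme-internal (2001/route/tribunal) claims are never citable.»

CONTENT (over `FreeBiResolventRowDiffCore`: entry formulas + the `ℓ¹` bounds of the differenced heat integral, and FILE B-b1 `biResolvent_apply_eq_integral`):
`biResolvent_eq_of_heatIntegral`, and the two letters in EXACTLY the displayed shape of `GaugeFactorRowDiffSocket.rowSum_shift_gaugeFactor_le` read on the cubic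
torus `Tor (fun _ ↦ Λ)` (`fine n (fun _ ↦ M₀) = fun _ ↦ n·M₀` by `rfl`, `Λ = n·M₀`): **`rowSum_shift_grad_biResolvent_le`** (`φ₂ ≤ n·C²(n²)⁻¹ = C²∕n`) and
**`rowSum_shift_grad_biResolvent_gradH_le`** (`φ₃ ≤ n²·D·C³((2∕3)^{−1∕2})³Γ(½)(n⁻¹)³ = D·C³((2∕3)^{−1∕2})³Γ(½)∕n`), `C = 1260·48^D`.
Unit `b2b-balaban-beta-d1-formalise-leaf-05` (gen 23), 2026-08-21; `LEAVES-FP.md` row «(T1′) SOCKET» (plan `HOME/…/leaf-05/g23/hAB-PLAN.md` v2).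
-/

noncomputable section

open scoped BigOperators ComplexConjugate Matrix
open Finset MeasureTheory Set

namespace Summit.QuantumFields.BalabanUV.Beta.FP.FreeBiResolventRowDiff

open Literature.Probability.LatticeModels
open Literature.MathematicalPhysics.QuantumFieldTheory.Balaban1983to89
open Literature.MathematicalPhysics.QuantumFieldTheory.Balaban1983to89.B5Prop11Plancherel (Tor fine unitVec shiftM)
open Literature.MathematicalPhysics.QuantumFieldTheory.Balaban1983to89.B5Action121 (LapS GradOp sdiff shiftS)
open Summit.QuantumFields.BalabanUV.Beta.FP.FreeBiResolventKernel (biResolvent_apply_eq_integral)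
open Summit.QuantumFields.BalabanUV.Beta.FP.FreeBiResolventRowDiffCore

/-! ## §4 The two FREE letters of `GaugeFactorRowDiffSocket` on the cubic torus -/

section Letters

variable {D : ℕ} (Λ n : ℕ) [NeZero Λ] [NeZero n]

/-- [our bookkeeping] the free bi-resolvent is the translation-invariant matrix of the (complexified) heat integral `k`. -/
theorem biResolvent_eq_of_heatIntegral :
    (LapS (fun _ : Fin D => Λ) (n : ℂ) + 1)⁻¹ * (LapS (fun _ : Fin D => Λ) (n : ℂ) + 1)⁻¹
      = Matrix.of (fun x y : Tor (fun _ : Fin D => Λ) =>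
          (((∫ u in Ioi (0 : ℝ), u * Real.exp (-u) * ∏ i, torusHeatKernel (2 * (n : ℝ) ^ 2 * u) ((x - y) i) : ℝ) : ℂ))) := by
  ext x y
  rw [Matrix.of_apply]
  exact biResolvent_apply_eq_integral Λ n x y

/-- [folklore] `‖↑a − ↑b − ↑c + ↑d‖ = |a − b − c + d|` for real `a b c d`. -/
theorem norm_ofReal_comb (a b c d : ℝ) : ‖(a : ℂ) - (b : ℂ) - (c : ℂ) + (d : ℂ)‖ = |a - b - c + d| := by
  rw [show (a : ℂ) - (b : ℂ) - (c : ℂ) + (d : ℂ) = ((a - b - c + d : ℝ) : ℂ) by push_cast; ring, Complex.norm_real, Real.norm_eq_abs]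

/-- [folklore] the eight-term version: `‖conj c·c·(↑(…) − ↑(…))‖ = ‖c‖²·|…|`. -/
theorem norm_conj_mul_mul_ofReal_sub (c : ℂ) (a b : ℝ) : ‖conj c * c * ((a : ℂ) - (b : ℂ))‖ = ‖c‖ ^ 2 * |a - b| := by
  rw [norm_mul, norm_mul, Complex.norm_conj, show (a : ℂ) - (b : ℂ) = ((a - b : ℝ) : ℂ) by push_cast; ring, Complex.norm_real,
    Real.norm_eq_abs]
  ring

/-- [our bookkeeping] **THE FREE LETTER `φ₂`**: on the cubic torus `(ℤ∕Λ)^D` with lattice factor `n`,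
`Σ_x ‖((S_ν − 1)·∂·(Δ+1)⁻¹(Δ+1)⁻¹)(i, x)‖ ≤ (1260·48^D)²∕n` for every row `i` and direction `ν` — uniformly in `Λ`. -/
theorem rowSum_shift_grad_biResolvent_le (ν : Fin D) (i : Tor (fun _ : Fin D => Λ) × Fin D) :
    ∑ x, ‖((shiftM (fun _ : Fin D => Λ) ν - 1) * GradOp (fun _ : Fin D => Λ) (n : ℂ)
      * ((LapS (fun _ : Fin D => Λ) (n : ℂ) + 1)⁻¹ * (LapS (fun _ : Fin D => Λ) (n : ℂ) + 1)⁻¹)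
        : Matrix (Tor (fun _ : Fin D => Λ) × Fin D) (Tor (fun _ : Fin D => Λ)) ℂ) i x‖
      ≤ (1260 * (48 : ℝ) ^ D) ^ 2 / n := by
  have hn0 : (0 : ℝ) < (n : ℝ) := by exact_mod_cast NeZero.pos n
  obtain ⟨x₀, μ⟩ := i
  set k : Tor (fun _ : Fin D => Λ) → ℝ :=
    fun z => ∫ u in Ioi (0 : ℝ), u * Real.exp (-u) * ∏ i, torusHeatKernel (2 * (n : ℝ) ^ 2 * u) (z i) with hk
  set f : Tor (fun _ : Fin D => Λ) → ℂ := fun z => ((k z : ℝ) : ℂ) with hf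
  have hmat : (LapS (fun _ : Fin D => Λ) (n : ℂ) + 1)⁻¹ * (LapS (fun _ : Fin D => Λ) (n : ℂ) + 1)⁻¹
      = Matrix.of (fun x y : Tor (fun _ : Fin D => Λ) => f (x - y)) := biResolvent_eq_of_heatIntegral Λ n
  rw [hmat]
  have hentry : ∀ x : Tor (fun _ : Fin D => Λ),
      ((shiftM (fun _ : Fin D => Λ) ν - (1 : Matrix (Tor (fun _ : Fin D => Λ) × Fin D) (Tor (fun _ : Fin D => Λ) × Fin D) ℂ))
        * GradOp (fun _ : Fin D => Λ) (n : ℂ) * Matrix.of (fun x y : Tor (fun _ : Fin D => Λ) => f (x - y))) (x₀, μ) x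
      = (n : ℂ) * (((k (x₀ - x + Pi.single ν 1 + Pi.single μ 1) : ℝ) : ℂ) - ((k (x₀ - x + Pi.single ν 1) : ℝ) : ℂ)
          - ((k (x₀ - x + Pi.single μ 1) : ℝ) : ℂ) + ((k (x₀ - x) : ℝ) : ℂ)) := by
    intro x
    rw [diff₂_entry]
    simp only [hf]
    rfl
  simp_rw [hentry, norm_mul, Complex.norm_natCast, norm_ofReal_comb]
  rw [← Finset.mul_sum]
  -- reindex `x ↦ z = x₀ − x`
  have hre : ∑ x : Tor (fun _ : Fin D => Λ), |k (x₀ - x + Pi.single ν 1 + Pi.single μ 1) - k (x₀ - x + Pi.single ν 1)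
        - k (x₀ - x + Pi.single μ 1) + k (x₀ - x)|
      = ∑ z : Tor (fun _ : Fin D => Λ), |k (z + Pi.single ν 1 + Pi.single μ 1) - k (z + Pi.single ν 1) - k (z + Pi.single μ 1) + k z| :=
    Fintype.sum_equiv (Equiv.subLeft x₀) _ _ fun x => rfl
  rw [hre]
  have h2 : ∑ z : Tor (fun _ : Fin D => Λ), |k (z + Pi.single ν 1 + Pi.single μ 1) - k (z + Pi.single ν 1) - k (z + Pi.single μ 1) + k z|
      ≤ (1260 * (48 : ℝ) ^ D) ^ 2 * ((n : ℝ) ^ 2)⁻¹ := sum_abs_diff₂_biKernel_le (Λ := Λ) (D := D) n ν μ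
  calc (n : ℝ) * _ ≤ (n : ℝ) * ((1260 * (48 : ℝ) ^ D) ^ 2 * ((n : ℝ) ^ 2)⁻¹) := mul_le_mul_of_nonneg_left h2 hn0.le
    _ = (1260 * (48 : ℝ) ^ D) ^ 2 / n := by field_simp

/-- [our bookkeeping] **THE FREE LETTER `φ₃`**: on the cubic torus `(ℤ∕Λ)^D` with lattice factor `n`,
`Σ_j ‖((S_ν − 1)·∂·(Δ+1)⁻¹(Δ+1)⁻¹·∂ᴴ)(i, j)‖ ≤ D·(1260·48^D)³·((2∕3)^{−1∕2})³·Γ(½)∕n` for every row `i` and direction `ν` — uniformly in `Λ`. -/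
theorem rowSum_shift_grad_biResolvent_gradH_le (ν : Fin D) (i : Tor (fun _ : Fin D => Λ) × Fin D) :
    ∑ j, ‖((shiftM (fun _ : Fin D => Λ) ν - 1) * GradOp (fun _ : Fin D => Λ) (n : ℂ)
      * ((LapS (fun _ : Fin D => Λ) (n : ℂ) + 1)⁻¹ * (LapS (fun _ : Fin D => Λ) (n : ℂ) + 1)⁻¹) * (GradOp (fun _ : Fin D => Λ) (n : ℂ))ᴴ
        : Matrix (Tor (fun _ : Fin D => Λ) × Fin D) (Tor (fun _ : Fin D => Λ) × Fin D) ℂ) i j‖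
      ≤ D * ((1260 * (48 : ℝ) ^ D) ^ 3 * ((2 / 3 : ℝ) ^ (-(1 / 2 : ℝ))) ^ 3 * Real.Gamma (1 / 2)) / n := by
  have hn0 : (0 : ℝ) < (n : ℝ) := by exact_mod_cast NeZero.pos n
  obtain ⟨x₀, μ⟩ := i
  set k : Tor (fun _ : Fin D => Λ) → ℝ :=
    fun z => ∫ u in Ioi (0 : ℝ), u * Real.exp (-u) * ∏ i, torusHeatKernel (2 * (n : ℝ) ^ 2 * u) (z i) with hk
  set f : Tor (fun _ : Fin D => Λ) → ℂ := fun z => ((k z : ℝ) : ℂ) with hf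
  set B : ℝ := (1260 * (48 : ℝ) ^ D) ^ 3 * ((2 / 3 : ℝ) ^ (-(1 / 2 : ℝ))) ^ 3 * Real.Gamma (1 / 2) with hB
  have hmat : (LapS (fun _ : Fin D => Λ) (n : ℂ) + 1)⁻¹ * (LapS (fun _ : Fin D => Λ) (n : ℂ) + 1)⁻¹
      = Matrix.of (fun x y : Tor (fun _ : Fin D => Λ) => f (x - y)) := biResolvent_eq_of_heatIntegral Λ n
  rw [hmat]
  -- the third difference of `k`, as a function of `z`
  set T : Fin D → Tor (fun _ : Fin D => Λ) → ℝ := fun μ' z =>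
    (k (z - Pi.single μ' 1 + Pi.single ν 1 + Pi.single μ 1) - k (z - Pi.single μ' 1 + Pi.single ν 1)
      - k (z - Pi.single μ' 1 + Pi.single μ 1) + k (z - Pi.single μ' 1))
    - (k (z + Pi.single ν 1 + Pi.single μ 1) - k (z + Pi.single ν 1) - k (z + Pi.single μ 1) + k z) with hT
  have hentry : ∀ (y : Tor (fun _ : Fin D => Λ)) (μ' : Fin D),
      ‖((shiftM (fun _ : Fin D => Λ) ν - (1 : Matrix (Tor (fun _ : Fin D => Λ) × Fin D) (Tor (fun _ : Fin D => Λ) × Fin D) ℂ))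
        * GradOp (fun _ : Fin D => Λ) (n : ℂ) * Matrix.of (fun x y : Tor (fun _ : Fin D => Λ) => f (x - y))
        * (GradOp (fun _ : Fin D => Λ) (n : ℂ))ᴴ) (x₀, μ) (y, μ')‖ = (n : ℝ) ^ 2 * |T μ' (x₀ - y)| := by
    intro y μ'
    rw [diff₃_entry]
    have e : (f (x₀ - y - unitVec (fun _ : Fin D => Λ) μ' + unitVec (fun _ : Fin D => Λ) ν + unitVec (fun _ : Fin D => Λ) μ)
          - f (x₀ - y - unitVec (fun _ : Fin D => Λ) μ' + unitVec (fun _ : Fin D => Λ) ν)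
          - f (x₀ - y - unitVec (fun _ : Fin D => Λ) μ' + unitVec (fun _ : Fin D => Λ) μ)
          + f (x₀ - y - unitVec (fun _ : Fin D => Λ) μ'))
        - (f (x₀ - y + unitVec (fun _ : Fin D => Λ) ν + unitVec (fun _ : Fin D => Λ) μ)
          - f (x₀ - y + unitVec (fun _ : Fin D => Λ) ν) - f (x₀ - y + unitVec (fun _ : Fin D => Λ) μ) + f (x₀ - y))
        = ((k (x₀ - y - Pi.single μ' 1 + Pi.single ν 1 + Pi.single μ 1) - k (x₀ - y - Pi.single μ' 1 + Pi.single ν 1)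
            - k (x₀ - y - Pi.single μ' 1 + Pi.single μ 1) + k (x₀ - y - Pi.single μ' 1) : ℝ) : ℂ)
          - ((k (x₀ - y + Pi.single ν 1 + Pi.single μ 1) - k (x₀ - y + Pi.single ν 1) - k (x₀ - y + Pi.single μ 1) + k (x₀ - y) : ℝ) : ℂ) := by
      simp only [hf]; push_cast; rfl
    rw [e, norm_conj_mul_mul_ofReal_sub, Complex.norm_natCast]
  rw [Fintype.sum_prod_type]
  simp_rw [hentry]
  rw [Finset.sum_comm]
  -- each `μ'`-slice: reindex `y ↦ z = x₀ − y` and apply §3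
  have hslice : ∀ μ' : Fin D, ∑ y : Tor (fun _ : Fin D => Λ), (n : ℝ) ^ 2 * |T μ' (x₀ - y)| ≤ (n : ℝ) ^ 2 * (B * ((n : ℝ)⁻¹) ^ 3) := by
    intro μ'
    rw [← Finset.mul_sum]
    refine mul_le_mul_of_nonneg_left ?_ (by positivity)
    have hre : ∑ y : Tor (fun _ : Fin D => Λ), |T μ' (x₀ - y)| = ∑ z : Tor (fun _ : Fin D => Λ), |T μ' z| :=
      Fintype.sum_equiv (Equiv.subLeft x₀) _ _ fun y => rfl
    rw [hre]
    exact sum_abs_diff₃_biKernel_le (Λ := Λ) (D := D) n ν μ μ'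
  calc ∑ μ' : Fin D, ∑ y : Tor (fun _ : Fin D => Λ), (n : ℝ) ^ 2 * |T μ' (x₀ - y)|
      ≤ ∑ _μ' : Fin D, (n : ℝ) ^ 2 * (B * ((n : ℝ)⁻¹) ^ 3) := Finset.sum_le_sum fun μ' _ => hslice μ'
    _ = D * ((n : ℝ) ^ 2 * (B * ((n : ℝ)⁻¹) ^ 3)) := by rw [Finset.sum_const, Finset.card_univ, Fintype.card_fin, nsmul_eq_mul]
    _ = D * B / n := by field_simp

end Letters

end Summit.QuantumFields.BalabanUV.Beta.FP.FreeBiResolventRowDiff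

end
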